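import Summits.CriticalPhenomena.CardyFormulaZ2.Theorems.CardyIKTransportCrudeToCanonical
import Literature.Probability.Percolation.CornerPercolation
import Literature.Probability.Percolation.BoxCrossingJordan

/-!
# Negative lemmas for the crux `CardySelfDualSegment.UniformMarginality` (stmt-CriticalPhenomena-5472), II —
# tightness at the endpoint `t = 1`: crude crossing probabilities of `M_1` never degenerate

Support file (refuter, cdisprove seat `refuter-cdisprove-stmt-CriticalPhenomena-5472-0`, cycle 1;
everything proved, no `sorry`, nothing defined, no named fact) for the disproof programme of the
crux `UniformMarginality` (work file `Cruxes/UniformMarginality/Disproof.lean`, §4).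

* `bondDomainCrossingProb_eventually_ge` / `_le` — for EVERY conformal rectangle `R` there is
  `c > 0` with `c ≤ bondDomainCrossingProb R δ ≤ 1 − c` for all small `δ > 0` (the eventual form of
  the tree's RSW corollary `discreteCrossingProb_clusterPt_mem_Ioo_holds`: a bound violated
  frequently would make `0` or `1` a cluster point).
* `cornerCrossingProb_one_eventually_ge` — hence, through `cornerPercolation_one` (`M_1` is bond
  percolation at `½`) and the exact inclusion G02 ⊆ crude (`bondDomainCrossingProb_le_crude`,
  `bond R (√2 δ) ≤ crude R δ`), the crude `M_1`-crossing probability of the crux satisfies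
  `cornerCrossingProb 1 R δ ≥ c(R) > 0` for all small `δ`, for every conformal rectangle `R` —
  wild Jordan boundaries (positive area, inward cusps, combs) included.

Moral (why the crux resists, §4 of the work file): no conformal rectangle can force every crude
crossing at arbitrarily fine meshes through bottlenecks of vanishing probability. The single-scale
comb of part I (`ShapeUniformity.lean`) forces all crossings through `N` zigzags of `H` corners at
ONE mesh, but a multi-scale comb doing so along `δ_k → 0` with `N_k 4^{-H_k} → 0` — which is what an
elementary counterexample to UM at `t₀ = 1` would need — does not exist. Any failure of UM at the
bond endpoint must come from the `t`-dependence of order-one, bulk-carried crossing probabilities.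
-/

noncomputable section

namespace Summit.CriticalPhenomena.CardyFormulaZ2.Theorems.UniformMarginality.Negative

open Filter Topology MeasureTheory
open Literature.Probability.Percolation Literature.Probability.LatticeModels
  Literature.Probability.RandomPlanarGeometry
open Summit.CriticalPhenomena.CardyFormulaZ2.Theorems (bondDomainCrossingProb_le_crude)

/-- **Eventual RSW lower bound for G02 crossings of a conformal rectangle**: some `c > 0` bounds
`bondDomainCrossingProb R δ` from below for all small `δ > 0` (else `0` would be a cluster point at
`0⁺`, contradicting `discreteCrossingProb_clusterPt_mem_Ioo_holds`). [folklore] -/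
theorem bondDomainCrossingProb_eventually_ge (R : ConformalRectangle) :
    ∃ c > 0, ∀ᶠ δ in 𝓝[>] (0 : ℝ), c ≤ bondDomainCrossingProb R δ := by
  by_contra hneg
  have h0 : MapClusterPt (0 : ℝ) (𝓝[>] (0 : ℝ))
      (fun δ => discreteCrossingProb half R.carrier δ (R.arc 0) (R.arc 2)) := by
    rw [mapClusterPt_iff_frequently]
    intro s hs
    obtain ⟨ε, hε, hball⟩ := Metric.mem_nhds_iff.1 hs
    have hfr : ∃ᶠ δ in 𝓝[>] (0 : ℝ), ¬ ε ≤ bondDomainCrossingProb R δ :=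
      Filter.not_eventually.1 fun h => hneg ⟨ε, hε, h⟩
    refine hfr.mono fun δ hδ => hball ?_
    have hnn : 0 ≤ bondDomainCrossingProb R δ := by
      rw [bondDomainCrossingProb_eq_measureReal]; exact measureReal_nonneg
    rw [Metric.mem_ball, Real.dist_eq, sub_zero]
    show |bondDomainCrossingProb R δ| < ε
    rw [abs_of_nonneg hnn]
    exact lt_of_not_ge hδ
  exact lt_irrefl (0 : ℝ) (discreteCrossingProb_clusterPt_mem_Ioo_holds R h0).1

/-- **Eventual RSW upper bound for G02 crossings of a conformal rectangle**: some `c > 0` has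
`bondDomainCrossingProb R δ ≤ 1 − c` for all small `δ > 0`. [folklore] -/
theorem bondDomainCrossingProb_eventually_le (R : ConformalRectangle) :
    ∃ c > 0, ∀ᶠ δ in 𝓝[>] (0 : ℝ), bondDomainCrossingProb R δ ≤ 1 - c := by
  by_contra hneg
  have h1 : MapClusterPt (1 : ℝ) (𝓝[>] (0 : ℝ))
      (fun δ => discreteCrossingProb half R.carrier δ (R.arc 0) (R.arc 2)) := by
    rw [mapClusterPt_iff_frequently]
    intro s hs
    obtain ⟨ε, hε, hball⟩ := Metric.mem_nhds_iff.1 hs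
    have hfr : ∃ᶠ δ in 𝓝[>] (0 : ℝ), ¬ bondDomainCrossingProb R δ ≤ 1 - ε :=
      Filter.not_eventually.1 fun h => hneg ⟨ε, hε, h⟩
    refine hfr.mono fun δ hδ => hball ?_
    have hle : bondDomainCrossingProb R δ ≤ 1 := by
      rw [bondDomainCrossingProb_eq_measureReal]; exact measureReal_le_one
    rw [Metric.mem_ball, Real.dist_eq]
    show |bondDomainCrossingProb R δ - 1| < ε
    rw [abs_sub_comm, abs_of_nonneg (by linarith)]
    have := lt_of_not_ge hδ
    linarith
  exact lt_irrefl (1 : ℝ) (discreteCrossingProb_clusterPt_mem_Ioo_holds R h1).2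

/-- **Tightness of the crux's crossing probabilities at the endpoint `t = 1`**: for every conformal
rectangle `R` there is `c > 0` with `c ≤ cornerCrossingProb 1 R δ` for all small `δ > 0` —
`M_1` is bond percolation at `½` (`cornerPercolation_one`), a G02 crossing at mesh `√2 δ` is a crude
crossing at mesh `δ` (`bondDomainCrossingProb_le_crude`), and G02 crossings obey the eventual RSW
lower bound. No Jordan boundary, however wild, forces all crude `M_1`-crossings through vanishing
bottlenecks. [folklore] -/
theorem cornerCrossingProb_one_eventually_ge (R : ConformalRectangle) :
    ∃ c > 0, ∀ᶠ δ in 𝓝[>] (0 : ℝ), c ≤ cornerCrossingProb 1 R δ := by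
  obtain ⟨c, hc, hev⟩ := bondDomainCrossingProb_eventually_ge R
  refine ⟨c, hc, ?_⟩
  -- `δ ↦ √2 δ` maps `δ → 0⁺` to `δ → 0⁺` (as in `ShearedSandwich.tendsto_sqrt_two_mul`)
  have htend : Tendsto (fun δ : ℝ => Real.sqrt 2 * δ) (𝓝[>] 0) (𝓝[>] 0) := by
    refine tendsto_nhdsWithin_iff.2 ⟨?_, ?_⟩
    · have h : Tendsto (fun δ : ℝ => Real.sqrt 2 * δ) (𝓝 0) (𝓝 (Real.sqrt 2 * 0)) :=
        tendsto_id.const_mul _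
      rw [mul_zero] at h
      exact h.mono_left nhdsWithin_le_nhds
    · filter_upwards [self_mem_nhdsWithin] with δ hδ
      exact mul_pos (Real.sqrt_pos.2 two_pos) hδ
  filter_upwards [htend.eventually hev, self_mem_nhdsWithin] with δ hδ hpos
  have h2 : (0 : ℝ) < Real.sqrt 2 := Real.sqrt_pos.2 two_pos
  have hle := bondDomainCrossingProb_le_crude R (δ := Real.sqrt 2 * δ) (mul_pos h2 hpos)
  rw [mul_div_cancel_left₀ δ h2.ne'] at hle
  rw [cornerCrossingProb_eq, cornerPercolation_one]
  exact hδ.trans hle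

end Summit.CriticalPhenomena.CardyFormulaZ2.Theorems.UniformMarginality.Negative

end
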